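import Summits.QuantumFields.YangMills.Theorems.FemtoTransferGap

/-!
# The femto-universe SPECTRUM of lattice `SU(2)` Yang–Mills in transfer-operator currency — node N34 of LADDER-YM typed
# (`FemtoLevelsOfRecord`: OPEN leaf, D-0061; seam to rung R2b′ proved)

Companion module `Theorems.FemtoTransferGapLevels` of `Theorems.FemtoTransferGap` (cell `ym-beyond`, seat P1, memo `run/shared/lean/pub/ym-beyond/ROUTE-P1.md` §30).  That module
states rung R2b′ (`FemtoGapOfRecord`: the zero-flux GAP `λ₁/λ₀ ≤ e^{−(ε₁λ − Cλ²)/L}` in the femto window).  Director-ym's ladder carries, above the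
rung, the node N34 «zero-mode asymptotics» — Lüscher's theorem proper: EVERY low-lying zero-flux level of the spatial transfer operator of `SU(2)`
Wilson theory on `(ℤ/L)³` is, in the femto window, `λ_k = λ₀ · exp(−(λ Δ_k + O(λ²))/L)` with `Δ_k = physLevel (k+1) − physLevel 1` the `k`-th
excitation of Lüscher's zero-momentum Hamiltonian `𝔥 = −½Δ + ¼Σ|x_i × x_j|²` over colour-invariant states [Luscher1983], [LuscherMunster1984].
This module types it in the same closed currency (no carrier, no unit map, no guard) and proves that its `k = 1` upper half IS the rung.

## Contents
* `levelValue ρ L β k` — the `k`-th transfer value FROM THE TOP (`k = 0, 1, 2, …`), Courant–Fischer form «`inf` over `k` physical constraint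
  functions of the `sup` of Rayleigh quotients over physical test functions orthogonal to them» [ReedSimonIV1978, Thm. XIII.1]; PROVED
  `levelValue_zero : levelValue ρ L β 0 = topValue ρ L β` and `levelValue_one : levelValue ρ L β 1 = secondValue ρ L β` (so the new definition
  extends, and does not re-define, the rung's objects).
* `levelGap k = physLevel (k+1) − physLevel 1` (`levelGap 1 = luscherEps1`, PROVED `levelGap_one`).
* `FemtoLevelsOfRecord` (`@[conjecture]`, OPEN): `∀ k, ∃ C λ₀ > 0, ∀ lam ∈ (0, λ₀], ∃ L₀, ∀ L ≥ L₀, ∀ β` in the window, the TWO-SIDED bound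
  `e^{−(λΔ_k + Cλ²)/L} λ₀ ≤ λ_k ≤ e^{−(λΔ_k − Cλ²)/L} λ₀` (`λ = luscherLambda β L`; constants depend on `k`: fixed level first, then `λ → 0`,
  the order in which [Luscher1983] is stated; degenerate `𝔥`-multiplets split only at the next order, inside `Cλ²`).
* SEAM (PROVED): `femtoGapOfRecord_of_levels : FemtoLevelsOfRecord → FemtoGapOfRecord`.

## WHAT THIS IS NOT
Not a proof of anything about Yang–Mills; not Lüscher's full asymptotic series (leading coefficient, `O(λ²)` remainder); not a statement about
non-zero electric flux or non-zero momenta; NOT THE CLAY GAP.  `[status: open]` docstrings are conjectures of record (ladder node text, never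
summit credit).
-/

set_option autoImplicit false

noncomputable section

open MeasureTheory Filter Topology Real
open Literature.MathematicalPhysics.QuantumFieldTheory
open Literature.MathematicalPhysics.QuantumLattice
open Literature.Analysis.OperatorTheory.YMMatrixModel

namespace Summit.QuantumFields.YangMills.Theorems.FemtoTransferGap

section Levels

variable {N : ℕ} {G : Type*} [Group G] [TopologicalSpace G] [IsTopologicalGroup G] [CompactSpace G]
  [MeasurableSpace G] [BorelSpace G]
variable (ρ : G →* Matrix (Fin N) (Fin N) ℂ)

/-- **`k`-th transfer value from the top, `λ_k(β, L)`** (`k = 0, 1, …`; min–max in Courant–Fischer form): the infimum over `k` physical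
zero-flux constraint functions `φ₀, …, φ_{k−1}` of the supremum of the Rayleigh quotients `⟨ψ,K_βψ⟩/⟨ψ,ψ⟩` over physical `ψ` orthogonal to all
of them — for the (positive, self-adjoint, Hilbert–Schmidt) zero-flux transfer operator this is its `k`-th largest eigenvalue counted with
multiplicity; the statements below bound the min–max numbers themselves. [cite: ReedSimonIV1978, Thm. XIII.1] [cite: LuscherMunster1984] -/
def levelValue (L : ℕ) [NeZero L] (β : ℝ) (k : ℕ) : ℝ :=
  sInf {s | ∃ φs : Fin k → (GaugeConfig 3 L G → ℝ), (∀ i, IsPhys (φs i)) ∧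
    s = sSup (rayleighSet ρ L β fun ψ => ∀ i, l2 ψ (φs i) = 0)}

/-- No constraint: `λ_0` is the rung module's `topValue`. [cite: ReedSimonIV1978, Thm. XIII.1] -/
theorem levelValue_zero (L : ℕ) [NeZero L] (β : ℝ) : levelValue ρ L β 0 = topValue ρ L β := by
  unfold levelValue topValue
  have h : {s : ℝ | ∃ φs : Fin 0 → (GaugeConfig 3 L G → ℝ), (∀ i, IsPhys (φs i)) ∧
      s = sSup (rayleighSet ρ L β fun ψ => ∀ i, l2 ψ (φs i) = 0)} = {sSup (rayleighSet ρ L β fun _ => True)} := by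
    ext s
    simp only [Set.mem_setOf_eq, Set.mem_singleton_iff, IsEmpty.forall_iff, true_and]
    constructor
    · rintro ⟨_, h⟩; exact h
    · intro h; exact ⟨finZeroElim, h⟩
  rw [h, csInf_singleton]

/-- One constraint: `λ_1` is the rung module's `secondValue`. [cite: ReedSimonIV1978, Thm. XIII.1] -/
theorem levelValue_one (L : ℕ) [NeZero L] (β : ℝ) : levelValue ρ L β 1 = secondValue ρ L β := by
  unfold levelValue secondValue
  congr 1
  ext s
  simp only [Set.mem_setOf_eq, Fin.forall_fin_one]
  constructor
  · rintro ⟨φs, h, hs⟩; exact ⟨φs 0, h, hs⟩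
  · rintro ⟨φ, h, hs⟩; exact ⟨fun _ => φ, h, hs⟩

end Levels

/-! ## The `SU(2)` spectrum leaf -/

/-- The `k`-th excitation coefficient of Lüscher's zero-momentum Hamiltonian in the colour-invariant sector, `Δ_k = μ_{k+1}^inv − μ_1^inv`
(min–max levels with multiplicity; `Δ_0 = 0`, `Δ_1 = ε₁`). [cite: Luscher1983, §1] [cite: LuscherMunster1984] -/
def levelGap (k : ℕ) : ℝ := physLevel (k + 1) - physLevel 1

/-- `Δ_1 = ε₁` (`luscherEps1 = physLevel 2 − physLevel 1`). [cite: Luscher1983, §1] -/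
theorem levelGap_one : levelGap 1 = luscherEps1 := rfl

/-- **LEAF `FemtoLevelsOfRecord` — node N34 of LADDER-YM («zero-mode asymptotics», transfer currency, `SU(2)`).**  For every level index `k`
there are `C` and `λ₀ > 0` such that for every `0 < lam ≤ λ₀`, for all sufficiently fine lattices `L ≥ L₀(k, lam)` and every `β` in the femto window
`λ(β,L) ∈ [lam, 2 lam]` (two-loop scaling label of `Theorems.FemtoTransferGap`), the `k`-th zero-flux transfer value satisfies the two-sided bound
`e^{−(λΔ_k + Cλ²)/L} λ₀ ≤ λ_k ≤ e^{−(λΔ_k − Cλ²)/L} λ₀`, i.e. the `k`-th zero-flux excitation energy per lattice time step is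
`E_k(β, L) = (λ Δ_k + O(λ²))/L` — Lüscher's law `E_k = ḡ^{2/3} Δ_k / L + O(ḡ^{4/3}/L)` for the whole low-lying zero-flux spectrum, uniformly deep
inside the femto regime.  OPEN: derived in renormalised (Bloch) perturbation theory [Luscher1983], [LuscherMunster1984]; the next order IS
`O(ḡ^{4/3})` ([KollerVanbaal1986, eq. (29): `M(0⁺)L = 2.2696390 ḡ^{2/3} − 0.7975278 ḡ^{4/3} + O(ḡ²)`); no constructive control of the small-volume
continuum limit of the lattice transfer spectrum is in print.  NOT THE CLAY GAP.
[cite: Luscher1983] [cite: LuscherMunster1984] [cite: KollerVanbaal1986, eq. (29)] [status: open] -/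
@[conjecture] def FemtoLevelsOfRecord : Prop :=
  ∀ k : ℕ, ∃ C lam0 : ℝ, 0 < lam0 ∧ ∀ lam : ℝ, 0 < lam → lam ≤ lam0 →
    ∃ L0 : ℕ, ∀ (L : ℕ) [NeZero L], L0 ≤ L → ∀ β : ℝ, InFemtoWindow lam β L →
      levelValue su2Rep L β k ≤
          Real.exp (-(levelGap k * luscherLambda β L - C * luscherLambda β L ^ 2) / L) * levelValue su2Rep L β 0 ∧
        Real.exp (-(levelGap k * luscherLambda β L + C * luscherLambda β L ^ 2) / L) * levelValue su2Rep L β 0 ≤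
          levelValue su2Rep L β k

/-- **SEAM (proved): N34 ⇒ R2b′.**  The `k = 1` upper half of `FemtoLevelsOfRecord`, read through `levelValue_one`, `levelValue_zero` and
`levelGap_one`, is `FemtoGapOfRecord` verbatim. [cite: Luscher1983] -/
theorem femtoGapOfRecord_of_levels (h : FemtoLevelsOfRecord) : FemtoGapOfRecord := by
  obtain ⟨C, lam0, hlam0, H⟩ := h 1
  refine ⟨C, lam0, hlam0, fun lam hl hle => ?_⟩
  obtain ⟨L0, HL⟩ := H lam hl hle
  refine ⟨L0, ?_⟩
  intro L _ hL β hw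
  have h1 := (HL L hL β hw).1
  rw [levelValue_one, levelValue_zero, levelGap_one] at h1
  exact h1

end Summit.QuantumFields.YangMills.Theorems.FemtoTransferGap

end
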